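import Summits.BirchSwinnertonDyer.BirchSwinnertonDyer.Theorems.KolyvaginDepthDoorDepthTableKurihara
import Summits.BirchSwinnertonDyer.BirchSwinnertonDyer.Theorems.KolyvaginDepthDoorDepthTableSteinWuthrichRows2
import Summits.BirchSwinnertonDyer.BirchSwinnertonDyer.Theorems.KolyvaginDepthDoorDepthTableSteinWuthrichRows4
import Summits.BirchSwinnertonDyer.BirchSwinnertonDyer.Theorems.KolyvaginDepthDoorDepthTableRankTwo571b1TwistBSDQuotientUniform
import Summits.BirchSwinnertonDyer.BirchSwinnertonDyer.Theorems.KolyvaginDepthDoorDepthTableRankTwo643a1TwistBSDQuotientUniform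
import Summits.BirchSwinnertonDyer.BirchSwinnertonDyer.Theorems.KolyvaginDepthDoorDepthTableRankTwo709a1TwistBSDQuotientUniform
import Summits.BirchSwinnertonDyer.Rank1Residual.Supersingular.CountPointsFast
import Summits.BirchSwinnertonDyer.Rank1Residual.Additive.X4ThreeKuriharaCertKernel
import HarnessLib

/-!
# Route `KolyvaginDepthDoor`, crux `KolyvaginDepthSupplyKN` (stmt-BirchSwinnertonDyer-22820) —
# DEPTH TABLE v17, E-SIDE TABLE at `p = 5` (part 1: `571b1`, `643a1`, `709a1`): `Ш(E/ℚ)[5] = 0` from the TREE'S OWN Kurihara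
# records (Kim 2026 Thm. 1.11 by name) — the `E`-side input of every v13–v16 row WITHOUT Stein–Wuthrich

Helper file of the lead prover of line `levelone` (kdd-p1 g21; `--supports stmt-BirchSwinnertonDyer-22820
--as helper`); it closes nothing and BSD is NOT proved by it.

Every row of the depth table v13–v16 carries the conjunct «`Ш(E/ℚ)[p] = 0`» of the rank-two curve as Stein–Wuthrich
2013 Thm. 1.1 BY NAME (a computational theorem: 1 534 422 pairs verified by the authors' code). The v17 generic
`sha_inf_torsionBy_eq_bot_of_kuriharaClaim` (`KolyvaginDepthDoorDepthTableKurihara`) reads the same conjunct off ONE unit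
mod-`p` Kurihara number at a cyclic level of depth `2 ≤ rank E` via Kim 2026 Thm. 1.11 — and for the table's curves such
numbers are ALREADY IN THE TREE as kernel-rechecked records (`Literature/NumberTheory/EllipticCurves/KuriharaCertificates/`,
fleet jobs, PARI `msfromell`, symbol-table hashes pinned). This file instantiates it for the six curves of the table at
which `p = 5` is admissible for Kim's theorem (good ordinary, `ρ̄_{E,5}` onto, NON-ANOMALOUS `a_5 ≢ 1`) AND the record's
level has cyclic `5`-parts (`25 ∤ #Ẽ(𝔽_ℓ)`):

* `571b1` = `[0, 1, 1, -4, 2]`: record `(5, 11·41 = 451, 2, 3)` (`RecordsN000550to000580`); `#Ẽ(𝔽_11) = 15`, `#Ẽ(𝔽_41) = 40`, `a_5 = -2`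
* `643a1` = `[1, 0, 0, -4, 3]`: record `(5, 31·41 = 1271, 2, 4)` (`RecordsN000615to000650`); `#Ẽ(𝔽_31) = 35`, `#Ẽ(𝔽_41) = 40`, `a_5 = -2`
* `709a1` = `[0, -1, 1, -2, 0]`: record `(5, 71·101 = 7171, 2, 4)` (`RecordsN000688to000715`); `#Ẽ(𝔽_71) = 80`, `#Ẽ(𝔽_101) = 110`, `a_5 = -3`
* `817a1` = `[0, 1, 1, 1, 6]`: record `(5, 31·401 = 12431, 2, 4)` (`RecordsN000816to000849`); `#Ẽ(𝔽_31) = 35`, `#Ẽ(𝔽_401) = 415`, `a_5 = -2`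
* `916c1` = `[0, 0, 0, -4, 1]`: record `(5, 11·31 = 341, 2, 1)` (`RecordsN000905to000928`); `#Ẽ(𝔽_11) = 15`, `#Ẽ(𝔽_31) = 30`, `a_5 = -3`
* `944e1` = `[0, 0, 0, -19, 34]`: record `(5, 31·191 = 5921, 2, 3)` (`RecordsN000930to000957`); `#Ẽ(𝔽_31) = 30`, `#Ẽ(𝔽_191) = 190`, `a_5 = -3`

(`389a1` is in `KolyvaginDepthDoorDepthTableKuriharaRow389a1`; `433a1, 446d1, 563a1, 664a1, 681c1, 794a1, 997b1` are
ANOMALOUS at `5` (`a_5 = −4`) and `655a1, 707a1, 718b1, 997c1` have a non-cyclic level prime at `5` — their records at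
`p ∈ {7, 11, 13}` serve instead, sequel file.) Per curve the kernel decides the two point counts (`countPointsFast`),
the Kolyvagin conditions `ℓ ≡ 1`, `a_ℓ ≡ 2 (mod 5)`, cyclicity, and `a_5 ≢ 1`; `5` good ordinary, `ρ̄_{E,5}` onto,
Kodaira–Néron at `5` and `2 ≤ rank_ℤ E(ℚ)` are the lineage's kernel theorems. RESULT per curve
(`C<label>.sha_inf_torsionBy_five_eq_bot_of_kuriharaClaim`): `Ш(E/ℚ)[5] = 0` — hence `corank_{ℤ₅} Ш(E)[5^∞] = 0`, X1 at
`5` for the curve — CONDITIONAL on Kim 2026 Thm. 1.11 (`hKim`), modularity (`hnf`), Mazur 1978 Cor. 4.1 (`hMaz`) BY NAME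
and on the record's CLAIM (`hδ`, read at level `N_E` through `KuriharaCertificates.Record.Claim`). Substituting it for
`C<label>.sha_inf_torsionBy_five_eq_bot hSW` in any v13–v16 row removes Stein–Wuthrich from that row. Per curve; nothing
class-wide; BSD is NOT proved by any of this.

References: [Kim2022StructureSelmer] Thm. 1.11, §1.2.2; [Mazur1978] Cor. 4.1; [CremonaAlgorithms1997] Table 1;
[SilvermanAEC2009] VII.3.1, X.4.2; [SteinWuthrich2013] Thm. 1.1 (the input replaced).
-/

set_option linter.dupNamespace false

noncomputable section

open scoped Classical NumberField

namespace Summit.BirchSwinnertonDyer.BirchSwinnertonDyer.Theorems.KolyvaginDepthDoor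

open Literature.NumberTheory.EllipticCurves Literature.NumberTheory.EllipticCurves.ModularForms
  WeierstrassCurve NumberField IsDedekindDomain
open Summit.BirchSwinnertonDyer.BirchSwinnertonDyer.Theorems
open Summit.BirchSwinnertonDyer.BirchSwinnertonDyer.Rank2Observatory
open Summit.BirchSwinnertonDyer.BirchSwinnertonDyer.Rank1Residual (IntModel.frobeniusTrace_eq)
open Summit.BirchSwinnertonDyer.Rank1Residual.Supersingular (natCard_point_eq_of_countPoints countPoints_eq_of_fast)
open Summit.BirchSwinnertonDyer.Rank1Residual.Additive (card_torsion_le_of_intModel_of_card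
  isKolyvaginPrime_of_intModel_of_card isKolyvaginProduct_mul)


/-! ## `571b1` = `[0, 1, 1, -4, 2]`: record `cert_571b1` @ `(5, 11·41)`, `δ̃ ≡ 3` -/

namespace C571b1

/-- `#Ẽ(𝔽_11) = 15` for `571b1` (`11 ≡ 1`, `a_11 = -3 ≡ 2 (mod 5)`, `25 ∤ 15`), kernel-decided (`countPointsFast`). [cite: CremonaAlgorithms1997, Table 1 (571b1)] -/
theorem card_11 :
    Nat.card (((⟨0, 1, 1, -4, 2⟩ : WeierstrassCurve ℤ).map (Int.castRingHom (ZMod 11))).toAffine.Point) = 15 :=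
  haveI : Fact (Nat.Prime 11) := ⟨by norm_num⟩
  natCard_point_eq_of_countPoints 0 1 1 (-4) 2 11 (by norm_num) (by decide +kernel) (n := 15)
    (countPoints_eq_of_fast (by decide +kernel))

/-- `#Ẽ(𝔽_41) = 40` for `571b1` (`41 ≡ 1`, `a_41 = 2 ≡ 2 (mod 5)`, `25 ∤ 40`), kernel-decided (`countPointsFast`). [cite: CremonaAlgorithms1997, Table 1 (571b1)] -/
theorem card_41 :
    Nat.card (((⟨0, 1, 1, -4, 2⟩ : WeierstrassCurve ℤ).map (Int.castRingHom (ZMod 41))).toAffine.Point) = 40 :=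
  haveI : Fact (Nat.Prime 41) := ⟨by norm_num⟩
  natCard_point_eq_of_countPoints 0 1 1 (-4) 2 41 (by norm_num) (by decide +kernel) (n := 40)
    (countPoints_eq_of_fast (by decide +kernel))

/-- **`451 = 11·41` is a cyclic Kolyvagin level for `(571b1, 5)`** — the level of the tree record `cert_571b1` at `p = 5`.
[cite: Kim2022StructureSelmer, §1.2.2 (PDF p. 5)] -/
theorem isCyclicKolyvaginLevel_5_451 :
    haveI := isGloballyMinimal_c571b1; haveI := Fact.mk (by norm_num : Nat.Prime 5);
    IsCyclicKolyvaginLevel ((⟨0, 1, 1, -4, 2⟩ : WeierstrassCurve ℤ).map (Int.castRingHom ℚ)) 5 451 := by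
  haveI := isElliptic_c571b1
  haveI := isGloballyMinimal_c571b1
  haveI := Fact.mk (by norm_num : Nat.Prime 5)
  haveI : Fact (Nat.Prime 11) := ⟨by norm_num⟩
  haveI : Fact (Nat.Prime 41) := ⟨by norm_num⟩
  have h₁ : Kato.IsKolyvaginPrime ((⟨0, 1, 1, -4, 2⟩ : WeierstrassCurve ℤ).map (Int.castRingHom ℚ)) 5 1 11 :=
    isKolyvaginPrime_of_intModel_of_card intModel 5 1 11 (by norm_num) (by decide +kernel) (by decide) card_11
      (by norm_num)
  have h₂ : Kato.IsKolyvaginPrime ((⟨0, 1, 1, -4, 2⟩ : WeierstrassCurve ℤ).map (Int.castRingHom ℚ)) 5 1 41 :=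
    isKolyvaginPrime_of_intModel_of_card intModel 5 1 41 (by norm_num) (by decide +kernel) (by decide) card_41
      (by norm_num)
  refine ⟨by simpa using isKolyvaginProduct_mul h₁ h₂ (by norm_num), fun ℓ hℓ hdvd ↦ ?_⟩
  rw [show (451 : ℕ) = 11 * 41 from rfl] at hdvd
  rcases (Nat.Prime.dvd_mul hℓ.out).mp hdvd with h | h
  · obtain rfl := (Nat.prime_dvd_prime_iff_eq hℓ.out (by norm_num)).mp h
    exact card_torsion_le_of_intModel_of_card intModel 5 11 card_11 (by norm_num)
  · obtain rfl := (Nat.prime_dvd_prime_iff_eq hℓ.out (by norm_num)).mp h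
    exact card_torsion_le_of_intModel_of_card intModel 5 41 card_41 (by norm_num)

/-- **`5` is non-anomalous for `571b1`**: `a_5 = 6 − 8 = -2`, `5 ∤ a_5 − 1`. [cite: SilvermanAEC2009, VII.3 Prop. 3.1] -/
theorem nonAnomalous_5 :
    haveI := isGloballyMinimal_c571b1; haveI := Fact.mk (by norm_num : Nat.Prime 5);
    ¬ ((5 : ℕ) : ℤ) ∣ ((⟨0, 1, 1, -4, 2⟩ : WeierstrassCurve ℤ).map (Int.castRingHom ℚ)).frobeniusTrace 5 - 1 := by
  haveI := isElliptic_c571b1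
  haveI := isGloballyMinimal_c571b1
  haveI := Fact.mk (by norm_num : Nat.Prime 5)
  rw [IntModel.frobeniusTrace_eq intModel card_5]
  decide

/-- **`Ш(571b1/ℚ)[5] = 0` FROM THE TREE RECORD `cert_571b1` @ `(5, 11·41)`** (Kurihara currency; replaces the Stein–Wuthrich
input `sha_inf_torsionBy_five_eq_bot hSW` of the v13–v16 rows of this curve): granted Kim 2026 Thm. 1.11 (`hKim`), modularity
(`hnf`), Mazur 1978 Cor. 4.1 (`hMaz`) BY NAME and the record's CLAIM `hδ` (read at level `N_E` through
`KuriharaCertificates.Record.Claim`), `#Sel_5(E/ℚ) ≤ 5² = 5^rank` and so `Ш(E/ℚ)[5] = 0` (`5` good ordinary `goodOrdinary_5`,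
`ρ̄_{E,5}` onto `hasSurjectiveModNGaloisRep_pow_5 1`, `nonAnomalous_5`, Kodaira–Néron `kodairaNeron_of_five_le 5`, `2 ≤ rank`
`KernelCerts001.C571b1.two_le_rank`). CONDITIONAL on the three named facts and the claim; per curve; BSD is not proved by it.
[cite: Kim2022StructureSelmer, Thm. 1.11 (PDF p. 8)] [cite: Mazur1978, Cor. 4.1] [cite: CremonaAlgorithms1997, Table 1 (571b1)] -/
theorem sha_inf_torsionBy_five_eq_bot_of_kuriharaClaim
    (hKim : Kim2022_card_selmerGroup_le_pow_of_kuriharaNumber_ne_zero)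
    (hnf : exists_isNewformOf) (hMaz : mazur_not_dvd_maninConstant_of_odd)
    (hδ : haveI := isElliptic_c571b1; haveI := isGloballyMinimal_c571b1;
      haveI : NeZero (((⟨0, 1, 1, -4, 2⟩ : WeierstrassCurve ℤ).map (Int.castRingHom ℚ)).conductorNorm ℤ) := neZero_conductorNorm_of_isElliptic _;
      haveI := Fact.mk (by norm_num : Nat.Prime 5);
      ∀ (D : ModularParametrizationData ((⟨0, 1, 1, -4, 2⟩ : WeierstrassCurve ℤ).map (Int.castRingHom ℚ)) (((⟨0, 1, 1, -4, 2⟩ : WeierstrassCurve ℤ).map (Int.castRingHom ℚ)).conductorNorm ℤ)), ¬ ((5 : ℕ) : ℤ) ∣ D.maninConstant →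
        (∃ u : ℚ, ‖(u : ℚ_[5])‖ = 1 ∧ ((⟨0, 1, 1, -4, 2⟩ : WeierstrassCurve ℤ).map (Int.castRingHom ℚ)).realPeriodRat = u * plusPeriod D.f) →
        ∃ ψ : (ℓ : ℕ) → (ZMod ℓ)ˣ →* Multiplicative (ZMod 5),
          (∀ ℓ ∈ (451 : ℕ).primeFactors, Function.Surjective (ψ ℓ)) ∧ kuriharaNumber D.f 5 451 ψ ≠ 0) :
    haveI := isElliptic_c571b1; haveI := isGloballyMinimal_c571b1; haveI := Fact.mk (by norm_num : Nat.Prime 5);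
    (((⟨0, 1, 1, -4, 2⟩ : WeierstrassCurve ℤ).map (Int.castRingHom ℚ)).sha ⊓ AddSubgroup.torsionBy ((⟨0, 1, 1, -4, 2⟩ : WeierstrassCurve ℤ).map (Int.castRingHom ℚ)).galH1 ((5 : ℕ) : ℤ) : AddSubgroup _) = ⊥ := by
  haveI := isElliptic_c571b1
  haveI := isGloballyMinimal_c571b1
  haveI iNZ : NeZero (((⟨0, 1, 1, -4, 2⟩ : WeierstrassCurve ℤ).map (Int.castRingHom ℚ)).conductorNorm ℤ) := neZero_conductorNorm_of_isElliptic _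
  haveI := Fact.mk (by norm_num : Nat.Prime 5)
  haveI : NeZero (451 : ℕ) := ⟨by norm_num⟩
  have hsur : ((⟨0, 1, 1, -4, 2⟩ : WeierstrassCurve ℤ).map (Int.castRingHom ℚ)).HasSurjectiveModNGaloisRep (5 ^ 1 : ℕ) := hasSurjectiveModNGaloisRep_pow_5 1
  rw [pow_one] at hsur
  have hν : (451 : ℕ).primeFactors.card ≤ ((⟨0, 1, 1, -4, 2⟩ : WeierstrassCurve ℤ).map (Int.castRingHom ℚ)).mordellWeilRank := by
    refine le_trans (le_of_eq ?_) KernelCerts001.C571b1.two_le_rank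
    rw [show (451 : ℕ) = 11 * 41 from rfl, Nat.primeFactors_mul (by norm_num) (by norm_num),
      Nat.Prime.primeFactors (by norm_num), Nat.Prime.primeFactors (by norm_num)]
    decide
  exact sha_inf_torsionBy_eq_bot_of_kuriharaClaim hKim hnf hMaz _ 5 le_rfl goodOrdinary_5.1 goodOrdinary_5.2 hsur
    nonAnomalous_5 (kodairaNeron_of_five_le 5 le_rfl) 451 isCyclicKolyvaginLevel_5_451 hν hδ

end C571b1


/-! ## `643a1` = `[1, 0, 0, -4, 3]`: record `cert_643a1` @ `(5, 31·41)`, `δ̃ ≡ 4` -/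

namespace C643a1

/-- `#Ẽ(𝔽_31) = 35` for `643a1` (`31 ≡ 1`, `a_31 = -3 ≡ 2 (mod 5)`, `25 ∤ 35`), kernel-decided (`countPointsFast`). [cite: CremonaAlgorithms1997, Table 1 (643a1)] -/
theorem card_31 :
    Nat.card (((⟨1, 0, 0, -4, 3⟩ : WeierstrassCurve ℤ).map (Int.castRingHom (ZMod 31))).toAffine.Point) = 35 :=
  haveI : Fact (Nat.Prime 31) := ⟨by norm_num⟩
  natCard_point_eq_of_countPoints 1 0 0 (-4) 3 31 (by norm_num) (by decide +kernel) (n := 35)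
    (countPoints_eq_of_fast (by decide +kernel))

/-- `#Ẽ(𝔽_41) = 40` for `643a1` (`41 ≡ 1`, `a_41 = 2 ≡ 2 (mod 5)`, `25 ∤ 40`), kernel-decided (`countPointsFast`). [cite: CremonaAlgorithms1997, Table 1 (643a1)] -/
theorem card_41 :
    Nat.card (((⟨1, 0, 0, -4, 3⟩ : WeierstrassCurve ℤ).map (Int.castRingHom (ZMod 41))).toAffine.Point) = 40 :=
  haveI : Fact (Nat.Prime 41) := ⟨by norm_num⟩
  natCard_point_eq_of_countPoints 1 0 0 (-4) 3 41 (by norm_num) (by decide +kernel) (n := 40)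
    (countPoints_eq_of_fast (by decide +kernel))

/-- **`1271 = 31·41` is a cyclic Kolyvagin level for `(643a1, 5)`** — the level of the tree record `cert_643a1` at `p = 5`.
[cite: Kim2022StructureSelmer, §1.2.2 (PDF p. 5)] -/
theorem isCyclicKolyvaginLevel_5_1271 :
    haveI := isGloballyMinimal_c643a1; haveI := Fact.mk (by norm_num : Nat.Prime 5);
    IsCyclicKolyvaginLevel ((⟨1, 0, 0, -4, 3⟩ : WeierstrassCurve ℤ).map (Int.castRingHom ℚ)) 5 1271 := by
  haveI := isElliptic_c643a1
  haveI := isGloballyMinimal_c643a1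
  haveI := Fact.mk (by norm_num : Nat.Prime 5)
  haveI : Fact (Nat.Prime 31) := ⟨by norm_num⟩
  haveI : Fact (Nat.Prime 41) := ⟨by norm_num⟩
  have h₁ : Kato.IsKolyvaginPrime ((⟨1, 0, 0, -4, 3⟩ : WeierstrassCurve ℤ).map (Int.castRingHom ℚ)) 5 1 31 :=
    isKolyvaginPrime_of_intModel_of_card intModel 5 1 31 (by norm_num) (by decide +kernel) (by decide) card_31
      (by norm_num)
  have h₂ : Kato.IsKolyvaginPrime ((⟨1, 0, 0, -4, 3⟩ : WeierstrassCurve ℤ).map (Int.castRingHom ℚ)) 5 1 41 :=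
    isKolyvaginPrime_of_intModel_of_card intModel 5 1 41 (by norm_num) (by decide +kernel) (by decide) card_41
      (by norm_num)
  refine ⟨by simpa using isKolyvaginProduct_mul h₁ h₂ (by norm_num), fun ℓ hℓ hdvd ↦ ?_⟩
  rw [show (1271 : ℕ) = 31 * 41 from rfl] at hdvd
  rcases (Nat.Prime.dvd_mul hℓ.out).mp hdvd with h | h
  · obtain rfl := (Nat.prime_dvd_prime_iff_eq hℓ.out (by norm_num)).mp h
    exact card_torsion_le_of_intModel_of_card intModel 5 31 card_31 (by norm_num)
  · obtain rfl := (Nat.prime_dvd_prime_iff_eq hℓ.out (by norm_num)).mp h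
    exact card_torsion_le_of_intModel_of_card intModel 5 41 card_41 (by norm_num)

/-- **`5` is non-anomalous for `643a1`**: `a_5 = 6 − 8 = -2`, `5 ∤ a_5 − 1`. [cite: SilvermanAEC2009, VII.3 Prop. 3.1] -/
theorem nonAnomalous_5 :
    haveI := isGloballyMinimal_c643a1; haveI := Fact.mk (by norm_num : Nat.Prime 5);
    ¬ ((5 : ℕ) : ℤ) ∣ ((⟨1, 0, 0, -4, 3⟩ : WeierstrassCurve ℤ).map (Int.castRingHom ℚ)).frobeniusTrace 5 - 1 := by
  haveI := isElliptic_c643a1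
  haveI := isGloballyMinimal_c643a1
  haveI := Fact.mk (by norm_num : Nat.Prime 5)
  rw [IntModel.frobeniusTrace_eq intModel card_5]
  decide

/-- **`Ш(643a1/ℚ)[5] = 0` FROM THE TREE RECORD `cert_643a1` @ `(5, 31·41)`** (Kurihara currency; replaces the Stein–Wuthrich
input `sha_inf_torsionBy_five_eq_bot hSW` of the v13–v16 rows of this curve): granted Kim 2026 Thm. 1.11 (`hKim`), modularity
(`hnf`), Mazur 1978 Cor. 4.1 (`hMaz`) BY NAME and the record's CLAIM `hδ` (read at level `N_E` through
`KuriharaCertificates.Record.Claim`), `#Sel_5(E/ℚ) ≤ 5² = 5^rank` and so `Ш(E/ℚ)[5] = 0` (`5` good ordinary `goodOrdinary_5`,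
`ρ̄_{E,5}` onto `hasSurjectiveModNGaloisRep_pow_5 1`, `nonAnomalous_5`, Kodaira–Néron `kodairaNeron_of_five_le 5`, `2 ≤ rank`
`KernelCerts001.C643a1.two_le_rank`). CONDITIONAL on the three named facts and the claim; per curve; BSD is not proved by it.
[cite: Kim2022StructureSelmer, Thm. 1.11 (PDF p. 8)] [cite: Mazur1978, Cor. 4.1] [cite: CremonaAlgorithms1997, Table 1 (643a1)] -/
theorem sha_inf_torsionBy_five_eq_bot_of_kuriharaClaim
    (hKim : Kim2022_card_selmerGroup_le_pow_of_kuriharaNumber_ne_zero)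
    (hnf : exists_isNewformOf) (hMaz : mazur_not_dvd_maninConstant_of_odd)
    (hδ : haveI := isElliptic_c643a1; haveI := isGloballyMinimal_c643a1;
      haveI : NeZero (((⟨1, 0, 0, -4, 3⟩ : WeierstrassCurve ℤ).map (Int.castRingHom ℚ)).conductorNorm ℤ) := neZero_conductorNorm_of_isElliptic _;
      haveI := Fact.mk (by norm_num : Nat.Prime 5);
      ∀ (D : ModularParametrizationData ((⟨1, 0, 0, -4, 3⟩ : WeierstrassCurve ℤ).map (Int.castRingHom ℚ)) (((⟨1, 0, 0, -4, 3⟩ : WeierstrassCurve ℤ).map (Int.castRingHom ℚ)).conductorNorm ℤ)), ¬ ((5 : ℕ) : ℤ) ∣ D.maninConstant →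
        (∃ u : ℚ, ‖(u : ℚ_[5])‖ = 1 ∧ ((⟨1, 0, 0, -4, 3⟩ : WeierstrassCurve ℤ).map (Int.castRingHom ℚ)).realPeriodRat = u * plusPeriod D.f) →
        ∃ ψ : (ℓ : ℕ) → (ZMod ℓ)ˣ →* Multiplicative (ZMod 5),
          (∀ ℓ ∈ (1271 : ℕ).primeFactors, Function.Surjective (ψ ℓ)) ∧ kuriharaNumber D.f 5 1271 ψ ≠ 0) :
    haveI := isElliptic_c643a1; haveI := isGloballyMinimal_c643a1; haveI := Fact.mk (by norm_num : Nat.Prime 5);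
    (((⟨1, 0, 0, -4, 3⟩ : WeierstrassCurve ℤ).map (Int.castRingHom ℚ)).sha ⊓ AddSubgroup.torsionBy ((⟨1, 0, 0, -4, 3⟩ : WeierstrassCurve ℤ).map (Int.castRingHom ℚ)).galH1 ((5 : ℕ) : ℤ) : AddSubgroup _) = ⊥ := by
  haveI := isElliptic_c643a1
  haveI := isGloballyMinimal_c643a1
  haveI iNZ : NeZero (((⟨1, 0, 0, -4, 3⟩ : WeierstrassCurve ℤ).map (Int.castRingHom ℚ)).conductorNorm ℤ) := neZero_conductorNorm_of_isElliptic _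
  haveI := Fact.mk (by norm_num : Nat.Prime 5)
  haveI : NeZero (1271 : ℕ) := ⟨by norm_num⟩
  have hsur : ((⟨1, 0, 0, -4, 3⟩ : WeierstrassCurve ℤ).map (Int.castRingHom ℚ)).HasSurjectiveModNGaloisRep (5 ^ 1 : ℕ) := hasSurjectiveModNGaloisRep_pow_5 1
  rw [pow_one] at hsur
  have hν : (1271 : ℕ).primeFactors.card ≤ ((⟨1, 0, 0, -4, 3⟩ : WeierstrassCurve ℤ).map (Int.castRingHom ℚ)).mordellWeilRank := by
    refine le_trans (le_of_eq ?_) KernelCerts001.C643a1.two_le_rank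
    rw [show (1271 : ℕ) = 31 * 41 from rfl, Nat.primeFactors_mul (by norm_num) (by norm_num),
      Nat.Prime.primeFactors (by norm_num), Nat.Prime.primeFactors (by norm_num)]
    decide
  exact sha_inf_torsionBy_eq_bot_of_kuriharaClaim hKim hnf hMaz _ 5 le_rfl goodOrdinary_5.1 goodOrdinary_5.2 hsur
    nonAnomalous_5 (kodairaNeron_of_five_le 5 le_rfl) 1271 isCyclicKolyvaginLevel_5_1271 hν hδ

end C643a1


/-! ## `709a1` = `[0, -1, 1, -2, 0]`: record `cert_709a1` @ `(5, 71·101)`, `δ̃ ≡ 4` -/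

namespace C709a1

/-- `#Ẽ(𝔽_71) = 80` for `709a1` (`71 ≡ 1`, `a_71 = -8 ≡ 2 (mod 5)`, `25 ∤ 80`), kernel-decided (`countPointsFast`). [cite: CremonaAlgorithms1997, Table 1 (709a1)] -/
theorem card_71 :
    Nat.card (((⟨0, -1, 1, -2, 0⟩ : WeierstrassCurve ℤ).map (Int.castRingHom (ZMod 71))).toAffine.Point) = 80 :=
  haveI : Fact (Nat.Prime 71) := ⟨by norm_num⟩
  natCard_point_eq_of_countPoints 0 (-1) 1 (-2) 0 71 (by norm_num) (by decide +kernel) (n := 80)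
    (countPoints_eq_of_fast (by decide +kernel))

/-- `#Ẽ(𝔽_101) = 110` for `709a1` (`101 ≡ 1`, `a_101 = -8 ≡ 2 (mod 5)`, `25 ∤ 110`), kernel-decided (`countPointsFast`). [cite: CremonaAlgorithms1997, Table 1 (709a1)] -/
theorem card_101 :
    Nat.card (((⟨0, -1, 1, -2, 0⟩ : WeierstrassCurve ℤ).map (Int.castRingHom (ZMod 101))).toAffine.Point) = 110 :=
  haveI : Fact (Nat.Prime 101) := ⟨by norm_num⟩
  natCard_point_eq_of_countPoints 0 (-1) 1 (-2) 0 101 (by norm_num) (by decide +kernel) (n := 110)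
    (countPoints_eq_of_fast (by decide +kernel))

/-- **`7171 = 71·101` is a cyclic Kolyvagin level for `(709a1, 5)`** — the level of the tree record `cert_709a1` at `p = 5`.
[cite: Kim2022StructureSelmer, §1.2.2 (PDF p. 5)] -/
theorem isCyclicKolyvaginLevel_5_7171 :
    haveI := isGloballyMinimal_c709a1; haveI := Fact.mk (by norm_num : Nat.Prime 5);
    IsCyclicKolyvaginLevel ((⟨0, -1, 1, -2, 0⟩ : WeierstrassCurve ℤ).map (Int.castRingHom ℚ)) 5 7171 := by
  haveI := isElliptic_c709a1
  haveI := isGloballyMinimal_c709a1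
  haveI := Fact.mk (by norm_num : Nat.Prime 5)
  haveI : Fact (Nat.Prime 71) := ⟨by norm_num⟩
  haveI : Fact (Nat.Prime 101) := ⟨by norm_num⟩
  have h₁ : Kato.IsKolyvaginPrime ((⟨0, -1, 1, -2, 0⟩ : WeierstrassCurve ℤ).map (Int.castRingHom ℚ)) 5 1 71 :=
    isKolyvaginPrime_of_intModel_of_card intModel 5 1 71 (by norm_num) (by decide +kernel) (by decide) card_71
      (by norm_num)
  have h₂ : Kato.IsKolyvaginPrime ((⟨0, -1, 1, -2, 0⟩ : WeierstrassCurve ℤ).map (Int.castRingHom ℚ)) 5 1 101 :=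
    isKolyvaginPrime_of_intModel_of_card intModel 5 1 101 (by norm_num) (by decide +kernel) (by decide) card_101
      (by norm_num)
  refine ⟨by simpa using isKolyvaginProduct_mul h₁ h₂ (by norm_num), fun ℓ hℓ hdvd ↦ ?_⟩
  rw [show (7171 : ℕ) = 71 * 101 from rfl] at hdvd
  rcases (Nat.Prime.dvd_mul hℓ.out).mp hdvd with h | h
  · obtain rfl := (Nat.prime_dvd_prime_iff_eq hℓ.out (by norm_num)).mp h
    exact card_torsion_le_of_intModel_of_card intModel 5 71 card_71 (by norm_num)
  · obtain rfl := (Nat.prime_dvd_prime_iff_eq hℓ.out (by norm_num)).mp h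
    exact card_torsion_le_of_intModel_of_card intModel 5 101 card_101 (by norm_num)

/-- **`5` is non-anomalous for `709a1`**: `a_5 = 6 − 9 = -3`, `5 ∤ a_5 − 1`. [cite: SilvermanAEC2009, VII.3 Prop. 3.1] -/
theorem nonAnomalous_5 :
    haveI := isGloballyMinimal_c709a1; haveI := Fact.mk (by norm_num : Nat.Prime 5);
    ¬ ((5 : ℕ) : ℤ) ∣ ((⟨0, -1, 1, -2, 0⟩ : WeierstrassCurve ℤ).map (Int.castRingHom ℚ)).frobeniusTrace 5 - 1 := by
  haveI := isElliptic_c709a1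
  haveI := isGloballyMinimal_c709a1
  haveI := Fact.mk (by norm_num : Nat.Prime 5)
  rw [IntModel.frobeniusTrace_eq intModel card_5]
  decide

/-- **`Ш(709a1/ℚ)[5] = 0` FROM THE TREE RECORD `cert_709a1` @ `(5, 71·101)`** (Kurihara currency; replaces the Stein–Wuthrich
input `sha_inf_torsionBy_five_eq_bot hSW` of the v13–v16 rows of this curve): granted Kim 2026 Thm. 1.11 (`hKim`), modularity
(`hnf`), Mazur 1978 Cor. 4.1 (`hMaz`) BY NAME and the record's CLAIM `hδ` (read at level `N_E` through
`KuriharaCertificates.Record.Claim`), `#Sel_5(E/ℚ) ≤ 5² = 5^rank` and so `Ш(E/ℚ)[5] = 0` (`5` good ordinary `goodOrdinary_5`,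
`ρ̄_{E,5}` onto `hasSurjectiveModNGaloisRep_pow_5 1`, `nonAnomalous_5`, Kodaira–Néron `kodairaNeron_of_five_le 5`, `2 ≤ rank`
`KernelCerts002.C709a1.two_le_rank`). CONDITIONAL on the three named facts and the claim; per curve; BSD is not proved by it.
[cite: Kim2022StructureSelmer, Thm. 1.11 (PDF p. 8)] [cite: Mazur1978, Cor. 4.1] [cite: CremonaAlgorithms1997, Table 1 (709a1)] -/
theorem sha_inf_torsionBy_five_eq_bot_of_kuriharaClaim
    (hKim : Kim2022_card_selmerGroup_le_pow_of_kuriharaNumber_ne_zero)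
    (hnf : exists_isNewformOf) (hMaz : mazur_not_dvd_maninConstant_of_odd)
    (hδ : haveI := isElliptic_c709a1; haveI := isGloballyMinimal_c709a1;
      haveI : NeZero (((⟨0, -1, 1, -2, 0⟩ : WeierstrassCurve ℤ).map (Int.castRingHom ℚ)).conductorNorm ℤ) := neZero_conductorNorm_of_isElliptic _;
      haveI := Fact.mk (by norm_num : Nat.Prime 5);
      ∀ (D : ModularParametrizationData ((⟨0, -1, 1, -2, 0⟩ : WeierstrassCurve ℤ).map (Int.castRingHom ℚ)) (((⟨0, -1, 1, -2, 0⟩ : WeierstrassCurve ℤ).map (Int.castRingHom ℚ)).conductorNorm ℤ)), ¬ ((5 : ℕ) : ℤ) ∣ D.maninConstant →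
        (∃ u : ℚ, ‖(u : ℚ_[5])‖ = 1 ∧ ((⟨0, -1, 1, -2, 0⟩ : WeierstrassCurve ℤ).map (Int.castRingHom ℚ)).realPeriodRat = u * plusPeriod D.f) →
        ∃ ψ : (ℓ : ℕ) → (ZMod ℓ)ˣ →* Multiplicative (ZMod 5),
          (∀ ℓ ∈ (7171 : ℕ).primeFactors, Function.Surjective (ψ ℓ)) ∧ kuriharaNumber D.f 5 7171 ψ ≠ 0) :
    haveI := isElliptic_c709a1; haveI := isGloballyMinimal_c709a1; haveI := Fact.mk (by norm_num : Nat.Prime 5);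
    (((⟨0, -1, 1, -2, 0⟩ : WeierstrassCurve ℤ).map (Int.castRingHom ℚ)).sha ⊓ AddSubgroup.torsionBy ((⟨0, -1, 1, -2, 0⟩ : WeierstrassCurve ℤ).map (Int.castRingHom ℚ)).galH1 ((5 : ℕ) : ℤ) : AddSubgroup _) = ⊥ := by
  haveI := isElliptic_c709a1
  haveI := isGloballyMinimal_c709a1
  haveI iNZ : NeZero (((⟨0, -1, 1, -2, 0⟩ : WeierstrassCurve ℤ).map (Int.castRingHom ℚ)).conductorNorm ℤ) := neZero_conductorNorm_of_isElliptic _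
  haveI := Fact.mk (by norm_num : Nat.Prime 5)
  haveI : NeZero (7171 : ℕ) := ⟨by norm_num⟩
  have hsur : ((⟨0, -1, 1, -2, 0⟩ : WeierstrassCurve ℤ).map (Int.castRingHom ℚ)).HasSurjectiveModNGaloisRep (5 ^ 1 : ℕ) := hasSurjectiveModNGaloisRep_pow_5 1
  rw [pow_one] at hsur
  have hν : (7171 : ℕ).primeFactors.card ≤ ((⟨0, -1, 1, -2, 0⟩ : WeierstrassCurve ℤ).map (Int.castRingHom ℚ)).mordellWeilRank := by
    refine le_trans (le_of_eq ?_) KernelCerts002.C709a1.two_le_rank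
    rw [show (7171 : ℕ) = 71 * 101 from rfl, Nat.primeFactors_mul (by norm_num) (by norm_num),
      Nat.Prime.primeFactors (by norm_num), Nat.Prime.primeFactors (by norm_num)]
    decide
  exact sha_inf_torsionBy_eq_bot_of_kuriharaClaim hKim hnf hMaz _ 5 le_rfl goodOrdinary_5.1 goodOrdinary_5.2 hsur
    nonAnomalous_5 (kodairaNeron_of_five_le 5 le_rfl) 7171 isCyclicKolyvaginLevel_5_7171 hν hδ

end C709a1


end Summit.BirchSwinnertonDyer.BirchSwinnertonDyer.Theorems.KolyvaginDepthDoor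

end
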